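import Summits.ValiantsHypothesis.ValiantsHypothesis.Theorems.GrenetZeonDualUnipotentThreeHalvesLongMassSubmodule
import Summits.ValiantsHypothesis.ValiantsHypothesis.Theorems.GrenetZeonDualUnipotentThreeHalvesLongMassLedgerTorusSlowCurve

/-!
# `GrenetZeon.DualUnipotentThreeHalves` (stmt-ValiantsHypothesis-24318), line `slow_core`, stub (c) `SlowCore.LongMassSlowLawInv`:
# THE MIXED-WORD DICTIONARY — a certificate IS the vanishing of all mixed words with more than `k` letters `w` (submodule currency)

The exact algebraic content of the WINDOW property of ✓ `longMassSlowLawInv_iff_submodule`.  For `A, w ∈ M_b(ℂ)` and a pattern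
`ε : Fin p → Bool` write `word ε := Π_i (if ε i then w else A)` (ordered product) and `|ε| := #{i : ε i}`.  The non-commutative binomial
expansion ★ `lineMat_pow_eq_sum_words`: `(A + s·w)^p = Σ_ε s^{|ε|} · word ε`; hence (`coeff_lineMat_pow_eq_sum_words`) the coefficient of `s^q` in
an entry of `(A + s w)^p` is the entry of `Σ_{|ε| = q} word ε`, and:

★★★ `window_iff_mixedWords` — `(V, W)` has the window property at order `k` (window `n`) IFF for all `A ∈ V`, `w ∈ W`, `p ≤ n − 1` and `q > k`:
`Σ_{ε : Fin p → Bool, |ε| = q} word ε (A, w) = 0`.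

So the registered research statement (c) reads, exactly: «every nilpotent `V ≤ M_b(ℂ)`, `dim V ≤ n²`, contains `W` with `n·k + codim_V W ≤ c√n·b`
such that every (A,w)-word sum with more than `k` letters `w ∈ W` (the others equal to one `A ∈ V`) and length `≤ n − 1` vanishes» — the pure words
(`q = p`: `w^p = 0`, index shadow ✓ `pow_eq_zero_of_window`) and the one-letter words (`q = p − 1`, ✓ `oneLetterWord_eq_zero_of_window`) being the
first two instances.  Honest framing.  A dictionary (`--supports stmt-ValiantsHypothesis-24318`), NOT progress on (c): (c) `SlowCore.LongMassSlowLawInv`,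
S3, the crux 24318, 8062 and `VP ≠ VNP` remain OPEN / NOT proved.  No sorry, no definitions, no named facts.
-/

-- single-conjunct layout: Sub = Summit, duplicated namespace component intended (the name is mandated)
set_option linter.dupNamespace false
set_option autoImplicit false

noncomputable section

namespace Summit.ValiantsHypothesis.ValiantsHypothesis.Theorems.GrenetZeon.LongMassHomogenise

open MvPolynomial Matrix
open scoped BigOperators
open Summit.ValiantsHypothesis.ValiantsHypothesis.Theorems.GrenetZeon.InitialForm.SlowCurve (totalDegree_le_iff_coeff)

variable {b : ℕ}

/-! ## §1 The non-commutative binomial expansion over words -/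

/-- ★ **WORD EXPANSION** in any ring: `(a + x·u)^p = Σ_{ε : Fin p → Bool} x^{|ε|} · Π_i (if ε i then u else a)` for a CENTRAL scalar `x`
(here: matrices over a commutative ring `R`, `x ∈ R`). -/
theorem add_smul_pow_eq_sum_words {R : Type*} [CommRing R] (a u : Matrix (Fin b) (Fin b) R) (x : R) (p : ℕ) :
    (a + x • u) ^ p = ∑ ε : Fin p → Bool, x ^ (∑ i, if ε i then 1 else 0) • (List.ofFn fun i => if ε i then u else a).prod := by
  induction p with
  | zero =>
    rw [pow_zero, Fintype.sum_unique]
    simp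
  | succ p ih =>
    rw [pow_succ', ih, Finset.mul_sum]
    -- split the words of length `p+1` by their FIRST letter
    rw [← (Fin.consEquiv fun _ : Fin (p + 1) => Bool).sum_comp, Fintype.sum_prod_type, Fintype.sum_bool, ← Finset.sum_add_distrib]
    refine Finset.sum_congr rfl fun ε _ => ?_
    simp only [Fin.consEquiv_apply, List.ofFn_succ, Fin.cons_zero, Fin.cons_succ, List.prod_cons, Fin.sum_univ_succ,
      if_true, zero_add, Bool.false_eq_true, if_false]
    rw [pow_add, pow_one, Matrix.add_mul, Matrix.smul_mul, Matrix.mul_smul, Matrix.mul_smul, smul_smul, add_comm]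

/-- The line matrix `A·C + s·(w·C)` expanded over words (the words are the `C`-images of the complex words). -/
theorem lineMat_pow_eq_sum_words (A w : Matrix (Fin b) (Fin b) ℂ) (p : ℕ) :
    (A.map (C : ℂ → MvPolynomial (Fin 1) ℂ) + (X 0 : MvPolynomial (Fin 1) ℂ) • w.map C) ^ p =
      ∑ ε : Fin p → Bool, (X 0 : MvPolynomial (Fin 1) ℂ) ^ (∑ i, if ε i then 1 else 0) •
        ((List.ofFn fun i => if ε i then w else A).prod).map (C : ℂ → MvPolynomial (Fin 1) ℂ) := by
  rw [add_smul_pow_eq_sum_words]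
  refine Finset.sum_congr rfl fun ε _ => ?_
  congr 1
  have hmap : ((List.ofFn fun i => if ε i then w else A).prod).map (C : ℂ → MvPolynomial (Fin 1) ℂ) =
      (C : ℂ →+* MvPolynomial (Fin 1) ℂ).mapMatrix (List.ofFn fun i => if ε i then w else A).prod :=
    (RingHom.mapMatrix_apply _ _).symm
  rw [hmap, map_list_prod, List.map_ofFn]
  congr 1
  refine List.ofFn_inj.mpr (funext fun i => ?_)
  simp only [Function.comp, RingHom.mapMatrix_apply]
  split_ifs <;> rfl

/-- ★ **COEFFICIENTS ARE WORD SUMS**: the coefficient of `s^q` in an entry of `(A + s w)^p` is the entry of `Σ_{|ε| = q} word ε`. -/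
theorem coeff_lineMat_pow_eq_sum_words (A w : Matrix (Fin b) (Fin b) ℂ) (p q : ℕ) (i j : Fin b) :
    coeff (Finsupp.single 0 q)
        (((A.map (C : ℂ → MvPolynomial (Fin 1) ℂ) + (X 0 : MvPolynomial (Fin 1) ℂ) • w.map C) ^ p :
          Matrix (Fin b) (Fin b) (MvPolynomial (Fin 1) ℂ)) i j) =
      (∑ ε ∈ (Finset.univ : Finset (Fin p → Bool)).filter (fun ε => (∑ i, if ε i then 1 else 0) = q),
        (List.ofFn fun i => if ε i then w else A).prod) i j := by
  classical
  rw [lineMat_pow_eq_sum_words, Matrix.sum_apply, coeff_sum, Finset.sum_filter, Matrix.sum_apply]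
  refine Finset.sum_congr rfl fun ε _ => ?_
  rw [Matrix.smul_apply, Matrix.map_apply, smul_eq_mul, mul_comm, C_mul_X_pow_eq_monomial, coeff_monomial]
  simp only [(Finsupp.single_injective (0 : Fin 1)).eq_iff]
  split_ifs <;> rfl

/-! ## §2 The dictionary -/

/-- ★★★ **THE MIXED-WORD DICTIONARY.**  `(V, W)` has the window property at order `k` (window `n`) iff every mixed word sum with MORE than `k`
letters `w` and length `≤ n − 1` vanishes on `V × W`. -/
theorem window_iff_mixedWords (V W : Submodule ℂ (Matrix (Fin b) (Fin b) ℂ)) (n k : ℕ) :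
    (∀ A ∈ V, ∀ w ∈ W, ∀ p : ℕ, p ≤ n - 1 → ∀ i j : Fin b,
      ((((A.map (C : ℂ → MvPolynomial (Fin 1) ℂ) + (X 0 : MvPolynomial (Fin 1) ℂ) • w.map C) ^ p :
        Matrix (Fin b) (Fin b) (MvPolynomial (Fin 1) ℂ)) i j).totalDegree ≤ k)) ↔
    (∀ A ∈ V, ∀ w ∈ W, ∀ p : ℕ, p ≤ n - 1 → ∀ q : ℕ, k < q →
      (∑ ε ∈ (Finset.univ : Finset (Fin p → Bool)).filter (fun ε => (∑ i, if ε i then 1 else 0) = q),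
        (List.ofFn fun i => if ε i then w else A).prod) = 0) := by
  constructor
  · intro h A hA w hw p hp q hq
    ext i j
    rw [← coeff_lineMat_pow_eq_sum_words, Matrix.zero_apply]
    exact (totalDegree_le_iff_coeff _ k).mp (h A hA w hw p hp i j) q hq
  · intro h A hA w hw p hp i j
    rw [totalDegree_le_iff_coeff]
    intro q hq
    rw [coeff_lineMat_pow_eq_sum_words, h A hA w hw p hp q hq, Matrix.zero_apply]

end Summit.ValiantsHypothesis.ValiantsHypothesis.Theorems.GrenetZeon.LongMassHomogenise

end
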